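import Mathlib.NumberTheory.Chebyshev
import Mathlib.Analysis.SpecialFunctions.Pow.Asymptotics
import HarnessLib

/-!
# Exponential growth of `lcm(1, …, m)` at rate `log 4` (Chebyshev)

Topic `NumberTheory/DiophantineApproximation`. For `D_m = lcm(1, …, m)` (Mathlib `Nat.lcmUpto`)
we record the growth bound that controls the common denominators
`lcm(1,…,3n) · lcm(1,…,n)²` of explicit Hermite–Padé approximations to `1, Li₁(1/N), Li₂(1/N)`
(the `DilogRigidity` programme): the exponential RATE of these denominators fixes the threshold
`N₀` beyond which the linear independence argument works, so one needs `D_m ≤ e^{(log 4 + ε) m}`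
for large `m`, with the elementary Chebyshev constant `log 4` (no prime number theorem).

* `eventually_two_mul_sqrt_mul_log_le` — `2 √x log x ≤ ε x` for large real `x`
  (`log x = o(√x)`, Mathlib `isLittleO_log_rpow_atTop`);
* `eventually_lcmUpto_le_exp` — for every `ε > 0`, `D_m ≤ e^{(log 4 + ε) m}` for all large `m`
  (`ψ(m) = log D_m`, Mathlib `Chebyshev.psi_eq_log_lcmUpto`, and Mathlib `Chebyshev.psi_le`:
  `ψ(x) ≤ x log 4 + 2 √x log x`).

The crude all-`m` bound `D_m ≤ e^{(log 4 + 4) m}` (Mathlib `Chebyshev.psi_le_const_mul_self`) is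
already in the tree as `Literature.NumberTheory.Transcendental.CalegariDimitrovTang.lcmUpto_le_exp`
(`Literature/NumberTheory/Transcendental/SiegelStepCoefficients.lean`) and is not restated here.

Source: P. L. Chebyshev, *Mémoire sur les nombres premiers*, J. Math. Pures Appl. 17 (1852),
366–390 (the bound `θ(x) ≤ x log 4` behind Mathlib's `Chebyshev.psi_le`). Everything here is
PROVED from Mathlib; no definitions, no named facts.
-/

namespace Literature.NumberTheory.DiophantineApproximation

open _root_.Filter _root_.Asymptotics

/-- `2 √x log x ≤ ε x` for all large real `x` (from `log x = o(x^{1/2})`,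
Mathlib `isLittleO_log_rpow_atTop`). [folklore] -/
theorem eventually_two_mul_sqrt_mul_log_le {ε : ℝ} (hε : 0 < ε) :
    ∀ᶠ x : ℝ in atTop, 2 * Real.sqrt x * Real.log x ≤ ε * x := by
  have h := (isLittleO_log_rpow_atTop (show (0 : ℝ) < 1 / 2 by norm_num)).def (half_pos hε)
  filter_upwards [h, eventually_ge_atTop 0] with x hx hx0
  rw [Real.norm_eq_abs, Real.norm_eq_abs, abs_of_nonneg (Real.rpow_nonneg hx0 _),
    ← Real.sqrt_eq_rpow] at hx
  have hlog : Real.log x ≤ ε / 2 * Real.sqrt x := (le_abs_self _).trans hx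
  calc 2 * Real.sqrt x * Real.log x ≤ 2 * Real.sqrt x * (ε / 2 * Real.sqrt x) :=
        mul_le_mul_of_nonneg_left hlog (by positivity)
    _ = ε * (Real.sqrt x * Real.sqrt x) := by ring
    _ = ε * x := by rw [Real.mul_self_sqrt hx0]

/-- **Growth of `lcm(1, …, m)` at Chebyshev's rate `log 4`**: for every `ε > 0`,
`lcm(1, …, m) ≤ e^{(log 4 + ε) m}` for all large `m` — from Mathlib's `Chebyshev.psi_le`
(`ψ(x) ≤ x log 4 + 2 √x log x`, Chebyshev 1852), `ψ(m) = log lcm(1,…,m)`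
(`Chebyshev.psi_eq_log_lcmUpto`) and `2 √m log m ≤ ε m` eventually. [folklore] -/
theorem eventually_lcmUpto_le_exp {ε : ℝ} (hε : 0 < ε) :
    ∀ᶠ m : ℕ in Filter.atTop, (Nat.lcmUpto m : ℝ) ≤ Real.exp ((Real.log 4 + ε) * m) := by
  have h := tendsto_natCast_atTop_atTop.eventually (eventually_two_mul_sqrt_mul_log_le hε)
  filter_upwards [h, eventually_ge_atTop 1] with m hm hm1
  have hpos : (0 : ℝ) < Nat.lcmUpto m := by exact_mod_cast Nat.lcmUpto_pos m
  rw [← Real.log_le_iff_le_exp hpos, ← Chebyshev.psi_eq_log_lcmUpto]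
  have h1 := Chebyshev.psi_le (x := (m : ℝ)) (by exact_mod_cast hm1)
  calc Chebyshev.psi m ≤ Real.log 4 * m + 2 * Real.sqrt m * Real.log m := h1
    _ ≤ Real.log 4 * m + ε * m := by linarith
    _ = (Real.log 4 + ε) * m := by ring

end Literature.NumberTheory.DiophantineApproximation
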